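import Mathlib.FieldTheory.SeparableDegree
import Mathlib.RingTheory.Valuation.LocalSubring
import Literature.NumberTheory.EllipticCurves.IsogenyFactorProofs
import Literature.NumberTheory.EllipticCurves.IsogenyDegreeKernelProofs
import HarnessLib

/-!
# Isogenies are onto `K̄`-points; the dual isogeny in characteristic `0` (*AEC* II.2.3, III.6.1)

Trunk T-ELLARITH (group G16); notion `cm_endomorphisms_isogeny`. A *proofs* file (theorems only)
over the prelude `Literature.NumberTheory.EllipticCurves.Isogeny`, combining the multiplication
isogeny `[m]` and the descent through `[m]` of `IsogenyMulProofs` / `IsogenyFactorProofs` with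
the places of `K̄(E)` and the field embedding `φ^* : K̄(E') → K̄(E)` of
`IsogenyDegreeKernelProofs` (Silverman, *AEC*, Thm. III.4.10(a), `#ker φ = deg_s φ`). It proves:

* `WeierstrassCurve.Isogeny.surjective`: **an isogeny of elliptic curves is onto `E'(K̄)`**
  (Silverman, *AEC*, Thm. II.2.3 for the morphism `φ`; Prop. III.4.2(a));
* `WeierstrassCurve.Isogeny.pullbackField_eq_fixedField_of_charZero`: in characteristic `0`,
  **`φ^* K̄(E') = K̄(E)^{ker φ}`** (`K̄(E)/φ^* K̄(E')` is Galois with group the kernel translations;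
  *AEC* Thm. III.4.10(b));
* `WeierstrassCurve.Isogeny.exists_dual_of_isElliptic`: **the dual isogeny** — in characteristic
  `0`, for every isogeny `φ : E → E'` of elliptic curves over `K` there is an isogeny `ψ : E' → E`
  over `K` with `ψ ∘ φ = [#ker φ] = [deg φ]` (Silverman, *AEC*, Thm. III.6.1(a)); whence
  `Isogeny.nonempty_symm_of_charZero`, `IsIsogenous.symm_of_charZero`.

The last item is the prelude's named fact `WeierstrassCurve.Isogeny.exists_dual`
(`∀ [CharZero K] (φ : Isogeny W W'), ∃ ψ : Isogeny W' W, ∀ P, ψ (φ P) = (φ.degree : ℤ) • P`,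
`Isogeny.degree = #ker`) **under the hypotheses `[W.IsElliptic] [W'.IsElliptic]`**, which the
prelude's `def` omits although its source (III.6.1: "Let `φ : E₁ → E₂` be a nonconstant isogeny"
of elliptic curves) carries them; the theorem proved here is what consumers working with
elliptic curves (e.g. `FaltingsECTateHomProofs`, hypothesis `hdual`) need. No discharge
`exists_dual_holds` of the hypothesis-free `def` is asserted.

## The arguments

* *Surjectivity* (`Isogeny.exists_finite_forall_exists_apply_eq`): for `Q ∈ E'(K̄)`, Chevalley's
  extension theorem (Mathlib `Ideal.image_subset_nonunits_valuationSubring`) gives a valuation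
  ring `B` of `K̄(E)` dominating `φ^*(K̄[E']_Q)`; it restricts to `K̄[E']_Q` on `K̄(E')` (a
  valuation ring is a maximal proper subring) and is the place of a point `P ∈ E(K̄)`
  (`place_surjective`); if `P` is a point of agreement of `φ` with its rational representation,
  the place at `P` lies above the place at `φ P` (`comap_pullbackHom_place`), so `φ P = Q`
  (`place_injective`). The finitely many exceptional `P` account for finitely many `Q`; the image
  of `φ`, a subgroup of the infinite group `E'(K̄)` with finite complement, is everything.
* *Fixed field*: `φ^* K̄(E') ⊆ K̄(E)^{ker φ}` (`Isogeny.pullbackField_le_fixedField`) and both have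
  codegree `#ker φ`: Artin's theorem for the fixed field, and
  `[K̄(E) : φ^* K̄(E')] = [K̄(E) : φ^* K̄(E')]_s = #ker φ` in characteristic `0`
  (`Isogeny.card_ker_eq_finSepDegree_holds`; every algebraic extension of a characteristic-`0`
  field is separable).
* *Dual isogeny* (Silverman's proof of III.6.1(a) in the separable case, via Cor. III.4.11): with
  `m = #ker φ`, `ker φ ⊆ E[m]` (Lagrange), so the kernel translations fix `[m]^* x`, `[m]^* y`,
  which therefore lie in `φ^* K̄(E')`: `[m]^* x = φ^* w₁`, `[m]^* y = φ^* w₂`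
  (`exists_pullbackHom_eq_pullback_zsmul_card_ker`). The homomorphism `ψ = [m] ∘ φ⁻¹` on
  `E'(K̄)` (`exists_addMonoidHom_comp_eq_card_ker_zsmul`, Mathlib `AddMonoidHom.liftOfSurjective`)
  agrees with the rational map `(w₁, w₂)` off a finite set (`isAlgebraicOn_of_comp_eq_card_ker_zsmul`:
  at a good `Q = φ P`, `x(ψ Q) = x(mP) = ([m]^* x)(P) = (φ^* w₁)(P) = w₁(Q)`), is
  `Γ_K`-equivariant and has finite kernel: it is an `Isogeny W' W`.

## Contents (all proved; no definitions)

`Isogeny.exists_finite_forall_exists_apply_eq`, `Isogeny.surjective`;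
`Isogeny.pullbackField_eq_fixedField_of_charZero`,
`Isogeny.exists_pullbackHom_eq_pullback_zsmul_card_ker`; `Isogeny.hasValueAt_pullbackHom_evalGeneric_div`
(values of `φ^*(g/h)`), `exists_addMonoidHom_comp_eq_card_ker_zsmul`,
`isAlgebraicOn_of_comp_eq_card_ker_zsmul`, `Isogeny.exists_dual_of_isElliptic`,
`Isogeny.nonempty_symm_of_charZero`, `IsIsogenous.symm_of_charZero`.

## References

* [SilvermanAEC2009] J. H. Silverman, *The Arithmetic of Elliptic Curves*, 2nd ed., GTM 106,
  Springer 2009: Thm. II.2.3, Prop. II.2.6, Thm. III.4.10, Cor. III.4.11, Thm. III.6.1, III.6.2.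

## Design

`noncomputable section`, `open scoped Classical`; deliberate dot-notation extensions in
`namespace WeierstrassCurve` (as the prelude). Theorems only; no statement of the tree is changed.
-/

noncomputable section

open scoped Classical

universe u

namespace WeierstrassCurve

open geomPoints Literature.NumberTheory.EllipticCurves Literature.NumberTheory.DiophantineGeometry.AlgFunctionField Literature.NumberTheory.EllipticCurves.SeparableDegreePlaces

variable {K : Type u} [Field K] {W W' : WeierstrassCurve K}

/-! ## Isogenies are onto `K̄`-points (Silverman, *AEC*, Thm. II.2.3) -/

namespace Isogeny

variable [W.IsElliptic] [W'.IsElliptic] (φ : Isogeny W W')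

/-- **All but finitely many points of `E'(K̄)` are values of `φ`**: for `Q` outside the finite set
of points whose place lies below the place of an exceptional point of `φ`, a valuation ring of
`K̄(E)` dominating `φ^*(K̄[E']_Q)` (Chevalley's extension theorem, Mathlib
`Ideal.image_subset_nonunits_valuationSubring`) restricts to `K̄[E']_Q` on `K̄(E')`, is the place
of a point `P` of agreement (`place_surjective` of `IsogenyDegreeKernelProofs`), and then
`φ P = Q` (`comap_pullbackHom_place`, `place_injective`). Silverman, *AEC*, proof of Thm. II.2.3
via II.2.4 (places of `K(C₁)` above places of `φ^* K(C₂)`). [folklore] -/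
theorem exists_finite_forall_exists_apply_eq :
    ∃ S : Set W'.geomPoints, S.Finite ∧ ∀ Q ∉ S, ∃ P : W.geomPoints, φ P = Q := by
  classical
  set ι : W'.geomFunctionField →+* W.geomFunctionField :=
    (φ.pullbackHom : W'.geomFunctionField →+* W.geomFunctionField) with hι
  have hιinj : Function.Injective ι := φ.pullbackHom.toRingHom.injective
  set S : Set W'.geomPoints := ⋃ P ∈ φ.badSet, {Q : W'.geomPoints |
      (W'.place Q).toValuationSubring = (W.place P).toValuationSubring.comap ι} with hS
  have hSfin : S.Finite := by
    refine Set.Finite.biUnion φ.finite_badSet' fun P _ ↦ Set.Subsingleton.finite ?_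
    intro Q hQ Q' hQ'
    exact place_injective (PlaceOver.ext (hQ.trans hQ'.symm))
  refine ⟨S, hSfin, fun Q hQ ↦ ?_⟩
  set O' : ValuationSubring W'.geomFunctionField := (W'.place Q).toValuationSubring with hO'
  -- Chevalley: a valuation ring `B` of `K̄(E)` containing `ι(O')` in which `ι(𝔪')` are non-units
  set g : O' →+* W.geomFunctionField := ι.comp O'.subtype with hg
  have hginj : Function.Injective g := hιinj.comp Subtype.val_injective
  set I : Ideal g.range := (IsLocalRing.maximalIdeal O').map g.rangeRestrict with hI
  have hI : I ≠ ⊤ := by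
    intro htop
    have h1 : (1 : g.range) ∈ I := htop ▸ Submodule.mem_top
    obtain ⟨x, hx, hx1⟩ :=
      (Ideal.mem_map_iff_of_surjective g.rangeRestrict g.rangeRestrict_surjective).mp h1
    have hx1' : x = 1 := hginj (by simpa using congrArg Subtype.val hx1)
    exact (IsLocalRing.maximalIdeal.isMaximal O').ne_top
      (Ideal.eq_top_of_isUnit_mem _ hx (hx1' ▸ isUnit_one))
  obtain ⟨B, hAB, hIB⟩ := Ideal.image_subset_nonunits_valuationSubring I hI
  have hle : O' ≤ B.comap ι := fun z hz ↦ by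
    rw [ValuationSubring.mem_comap]
    exact hAB ⟨⟨z, hz⟩, rfl⟩
  have hne : B.comap ι ≠ ⊤ := by
    obtain ⟨π, hπ, hπ0⟩ := exists_mem_nonunits_ne_zero O' (W'.place Q).ne_top
    have hπO : π ∈ O' := O'.nonunits_subset hπ
    have hπB : ι π ∈ B.nonunits :=
      hIB ⟨g.rangeRestrict ⟨π, hπO⟩, Ideal.mem_map_of_mem _
        ((ValuationSubring.coe_mem_nonunits_iff (a := (⟨π, hπO⟩ : O'))).mp hπ), rfl⟩
    intro htop
    have hinv : (ι π)⁻¹ ∈ B := by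
      have : π⁻¹ ∈ B.comap ι := htop ▸ ValuationSubring.mem_top _
      rwa [ValuationSubring.mem_comap, map_inv₀] at this
    exact not_mem_nonunits_of_inv_mem B ((map_ne_zero ι).mpr hπ0) hinv hπB
  have hcomap : O' = B.comap ι := ValuationSubring.eq_of_le_of_ne_top O' hle hne
  -- `B` is the place of a point `P`
  have hBtop : B ≠ ⊤ := by
    intro h
    apply hne
    rw [h]
    exact eq_top_iff.mpr fun z _ ↦ ValuationSubring.mem_comap.mpr (ValuationSubring.mem_top _)
  have hBK : ∀ c : AlgebraicClosure K, algebraMap (AlgebraicClosure K) W.geomFunctionField c ∈ B := by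
    intro c
    have h1 : algebraMap (AlgebraicClosure K) W'.geomFunctionField c ∈ B.comap ι :=
      hle ((W'.place Q).algebraMap_mem c)
    rw [ValuationSubring.mem_comap] at h1
    change φ.pullbackHom (algebraMap (AlgebraicClosure K) W'.geomFunctionField c) ∈ B at h1
    rwa [AlgHom.commutes] at h1
  obtain ⟨𝔔, h𝔔⟩ := PlaceOver.exists_toValuationSubring_eq B hBtop hBK
  obtain ⟨P, hP⟩ := place_surjective 𝔔
  have hPB : (W.place P).toValuationSubring = B := by rw [hP, h𝔔]
  by_cases hPbad : P ∈ φ.badSet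
  · refine (hQ (Set.mem_iUnion₂.mpr ⟨P, hPbad, ?_⟩)).elim
    change O' = _
    rw [hPB]
    exact hcomap
  · refine ⟨P, ?_⟩
    have hPgood : AgreesWithRationalMapAt W W' φ.rationalRep.P₁ φ.rationalRep.Q₁ φ.rationalRep.P₂
        φ.rationalRep.Q₂ φ P := not_not.mp hPbad
    have h1 := φ.comap_pullbackHom_place hPgood
    rw [hPB] at h1
    change B.comap ι = _ at h1
    rw [← hcomap] at h1
    exact (place_injective (PlaceOver.ext h1)).symm

/-- **Isogenies of elliptic curves are surjective on `K̄`-points** (Silverman, *AEC*, Thm. II.2.3: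
a non-constant morphism of curves is surjective; III.4.2(a)): the image is a subgroup of `E'(K̄)`
with finite complement (`exists_finite_forall_exists_apply_eq`), hence everything.
[cite: SilvermanAEC2009, Thm. II.2.3] -/
theorem surjective : Function.Surjective φ := by
  obtain ⟨S, hS, hSφ⟩ := φ.exists_finite_forall_exists_apply_eq
  intro Q
  have hfin : (S ∪ (fun R ↦ Q - R) ⁻¹' S).Finite :=
    hS.union (hS.preimage (sub_right_injective.injOn))
  obtain ⟨R, hR⟩ := hfin.infinite_compl.nonempty
  simp only [Set.mem_compl_iff, Set.mem_union, Set.mem_preimage, not_or] at hR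
  obtain ⟨P₁, hP₁⟩ := hSφ R hR.1
  obtain ⟨P₂, hP₂⟩ := hSφ (Q - R) hR.2
  exact ⟨P₂ + P₁, by rw [map_add, hP₁, hP₂, sub_add_cancel]⟩

end Isogeny

/-! ## In characteristic `0`: `φ^* K̄(E') = K̄(E)^{ker φ}` -/

namespace Isogeny

variable [W.IsElliptic] [W'.IsElliptic] (φ : Isogeny W W')

/-- **In characteristic `0`, `φ^* K̄(E')` is the fixed field of the kernel translations**, i.e.
`K̄(E)/φ^* K̄(E')` is Galois with group `ker φ`: `φ^* K̄(E') ⊆ K̄(E)^{ker φ}`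
(`pullbackField_le_fixedField`) and both have codegree `#ker φ` — the fixed field by Artin's
theorem, `φ^* K̄(E')` because `[K̄(E) : φ^* K̄(E')] = [K̄(E) : φ^* K̄(E')]_s = #ker φ` (every
extension is separable in characteristic `0`; the tree's `Isogeny.card_ker_eq_finSepDegree_holds`,
*AEC* III.4.10(a)). Silverman, *AEC*, Thm. III.4.10(b),(c). [cite: SilvermanAEC2009, Thm. III.4.10(b)] -/
theorem pullbackField_eq_fixedField_of_charZero [CharZero K] :
    φ.pullbackField = IntermediateField.fixedField
      ((AddSubgroup.toSubgroup φ.toAddMonoidHom.ker).map W.transHom) := by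
  set L := W.geomFunctionField
  set H : Subgroup (L ≃ₐ[AlgebraicClosure K] L) :=
    (AddSubgroup.toSubgroup φ.toAddMonoidHom.ker).map W.transHom with hH
  haveI hfin : FiniteDimensional φ.pullbackField L := finiteDimensional_pullbackField_holds W W' φ
  -- characteristic zero: the extension is separable
  haveI : CharZero L := charZero_of_injective_ringHom (algebraMap K L).injective
  haveI : CharZero φ.pullbackField := (algebraMap φ.pullbackField L).charZero
  haveI : Algebra.IsSeparable φ.pullbackField L := Algebra.IsAlgebraic.isSeparable_of_perfectField
  refine IntermediateField.eq_of_le_of_finrank_eq' φ.pullbackField_le_fixedField ?_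
  have hcardK : Nat.card (AddSubgroup.toSubgroup φ.toAddMonoidHom.ker) =
      Nat.card φ.toAddMonoidHom.ker :=
    Nat.card_congr (Equiv.subtypeEquiv Multiplicative.toAdd fun _ ↦ Iff.rfl)
  have hcard : Nat.card H = Nat.card φ.toAddMonoidHom.ker := by
    rw [hH, Subgroup.card_map_of_injective transHom_injective, hcardK]
  haveI : Finite H := Nat.finite_of_card_ne_zero (by
    rw [hcard]; exact (Nat.card_pos (α := φ.toAddMonoidHom.ker)).ne')
  letI : Fintype H := Fintype.ofFinite H
  have h1 : Module.finrank (IntermediateField.fixedField H) L = Fintype.card H :=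
    FixedPoints.finrank_eq_card H L
  rw [h1, ← Nat.card_eq_fintype_card, hcard, card_ker_eq_finSepDegree_holds W W' φ]
  exact (Field.finSepDegree_eq_finrank_of_isSeparable _ _).symm

/-- **`[m]^* x, [m]^* y ∈ φ^* K̄(E')` for `m = #ker φ`** (characteristic `0`): the kernel
translations fix `[m]^* x` and `[m]^* y` because `ker φ ⊆ E[m]` (Lagrange), and
`K̄(E)^{ker φ} = φ^* K̄(E')`. So there are `w₁, w₂ ∈ K̄(E')` with `φ^* wᵢ = [m]^* x`, `[m]^* y` —
Silverman's construction of the dual isogeny through Cor. III.4.11 (proof of Thm. III.6.1(a),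
separable case: "`ker φ ⊆ E[m]`, so `[m] = φ̂ ∘ φ`"). [cite: SilvermanAEC2009, Thm. III.6.1(a) (proof)] -/
theorem exists_pullbackHom_eq_pullback_zsmul_card_ker [CharZero K]
    (hm : (Nat.card φ.toAddMonoidHom.ker : ℤ) ≠ 0) :
    (∃ w₁ : W'.geomFunctionField, φ.pullbackHom w₁ =
        (Isogeny.zsmul W (Nat.card φ.toAddMonoidHom.ker : ℤ) hm).pullbackX) ∧
      ∃ w₂ : W'.geomFunctionField, φ.pullbackHom w₂ =
        (Isogeny.zsmul W (Nat.card φ.toAddMonoidHom.ker : ℤ) hm).pullbackY := by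
  set μ := Isogeny.zsmul W (Nat.card φ.toAddMonoidHom.ker : ℤ) hm with hμ
  have hker : ∀ T ∈ φ.toAddMonoidHom.ker, μ T = 0 := by
    intro T hT
    rw [hμ, Isogeny.zsmul_apply, natCast_zsmul]
    have h := card_nsmul_eq_zero' (G := φ.toAddMonoidHom.ker) (x := ⟨T, hT⟩)
    exact congrArg Subtype.val h
  have hmemX : μ.pullbackX ∈ φ.pullbackField := by
    rw [φ.pullbackField_eq_fixedField_of_charZero, IntermediateField.mem_fixedField_iff]
    rintro f hf
    obtain ⟨g, hg, rfl⟩ := Subgroup.mem_map.mp hf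
    have hg' : g.toAdd ∈ φ.toAddMonoidHom.ker := by simpa using hg
    exact μ.transAlgHom_pullbackX (hker _ hg')
  have hmemY : μ.pullbackY ∈ φ.pullbackField := by
    rw [φ.pullbackField_eq_fixedField_of_charZero, IntermediateField.mem_fixedField_iff]
    rintro f hf
    obtain ⟨g, hg, rfl⟩ := Subgroup.mem_map.mp hf
    have hg' : g.toAdd ∈ φ.toAddMonoidHom.ker := by simpa using hg
    exact μ.transAlgHom_pullbackY (hker _ hg')
  exact ⟨(φ.mem_pullbackField_iff _).mp hmemX, (φ.mem_pullbackField_iff _).mp hmemY⟩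

end Isogeny

/-! ## The dual isogeny in characteristic `0` (Silverman, *AEC*, Thm. III.6.1) -/

section Dual

variable [W.IsElliptic] [W'.IsElliptic]

omit [W'.IsElliptic] in
/-- **Values of `φ^* (g/h)`**: at a point of agreement `P` of `φ` with `φ P = Q` affine and
`h(Q) ≠ 0`, the function `φ^*(g(x', y')/h(x', y'))` has the value `g(Q)/h(Q)` (the tree's
`Isogeny.hasValueAt_pullbackHom_algebraMap`). [folklore] -/
theorem Isogeny.hasValueAt_pullbackHom_evalGeneric_div (φ : Isogeny W W') {P : W.geomPoints}
    (hP : AgreesWithRationalMapAt W W' φ.rationalRep.P₁ φ.rationalRep.Q₁ φ.rationalRep.P₂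
      φ.rationalRep.Q₂ φ P)
    (g h : MvPolynomial (Fin 2) (AlgebraicClosure K)) (hh : MvPolynomial.eval (xy (φ P)) h ≠ 0) :
    W.HasValueAt (φ.pullbackHom (W'.evalGeneric g / W'.evalGeneric h)) P
      (MvPolynomial.eval (xy (φ P)) g / MvPolynomial.eval (xy (φ P)) h) := by
  have hP0 : P ≠ 0 := (agreesWithRationalMapAt_iff.mp hP).1
  obtain ⟨a, b, hab, e⟩ := geomPoints.exists_eq_some hP.apply_ne_zero
  have hv : ∀ q : MvPolynomial (Fin 2) (AlgebraicClosure K),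
      W.HasValueAt (φ.pullbackHom (W'.evalGeneric q)) P (MvPolynomial.eval (xy (φ P)) q) := by
    intro q
    have h1 := φ.hasValueAt_pullbackHom_algebraMap hP hab e
      (Affine.CoordinateRing.mk _ ((Polynomial.Bivariate.equivMvPolynomial _).symm q))
    rw [evalAt_mk_equivMvPolynomial_symm] at h1
    rw [e, xy_some]
    exact h1
  rw [map_div₀]
  exact (hv g).div hP0 (hv h) hh

/-- **The dual isogeny on points**, `ψ = [m] ∘ φ⁻¹` with `m = #ker φ`: `φ` is onto `E'(K̄)`
(`Isogeny.surjective`) and `ker φ ⊆ E[m]`, so `[m]` factors through `φ` (Mathlib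
`AddMonoidHom.liftOfSurjective`). Silverman, *AEC*, Thm. III.6.1(a). [folklore] -/
theorem exists_addMonoidHom_comp_eq_card_ker_zsmul (φ : Isogeny W W') :
    ∃ ψ : W'.geomPoints →+ W.geomPoints, ∀ P, ψ (φ P) = (Nat.card φ.toAddMonoidHom.ker : ℤ) • P := by
  have hker : φ.toAddMonoidHom.ker ≤
      (zsmulAddGroupHom (Nat.card φ.toAddMonoidHom.ker : ℤ) : W.geomPoints →+ W.geomPoints).ker := by
    intro T hT
    rw [AddMonoidHom.mem_ker, zsmulAddGroupHom_apply, natCast_zsmul]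
    exact congrArg Subtype.val (card_nsmul_eq_zero' (G := φ.toAddMonoidHom.ker) (x := ⟨T, hT⟩))
  refine ⟨φ.toAddMonoidHom.liftOfSurjective φ.surjective ⟨zsmulAddGroupHom _, hker⟩, fun P ↦ ?_⟩
  exact φ.toAddMonoidHom.liftOfRightInverse_comp_apply (Function.surjInv φ.surjective)
    (Function.rightInverse_surjInv φ.surjective) ⟨zsmulAddGroupHom _, hker⟩ P

/-- **`ψ = [m] ∘ φ⁻¹` is algebraic** (characteristic `0`): with `[m]^* x = φ^* (g₁/h₁)`,
`[m]^* y = φ^* (g₂/h₂)` (`Isogeny.exists_pullbackHom_eq_pullback_zsmul_card_ker`), for `Q = φ P`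
with `P` a point of agreement, `mP ≠ O` and `h₁(Q) h₂(Q) ≠ 0`:
`x(ψ Q) = x(mP) = ([m]^* x)(P) = (φ^*(g₁/h₁))(P) = g₁(Q)/h₁(Q)`, so `ψ` agrees with
`(g₁/h₁, g₂/h₂)` off a finite set. Silverman, *AEC*, Thm. III.6.1(a) with Cor. III.4.11.
[cite: SilvermanAEC2009, Thm. III.6.1(a) (proof)] -/
theorem isAlgebraicOn_of_comp_eq_card_ker_zsmul [CharZero K] (φ : Isogeny W W')
    {ψ : W'.geomPoints →+ W.geomPoints}
    (hψ : ∀ P, ψ (φ P) = (Nat.card φ.toAddMonoidHom.ker : ℤ) • P) : IsAlgebraicOn W' W ψ := by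
  set m : ℤ := (Nat.card φ.toAddMonoidHom.ker : ℤ) with hm_def
  have hm : m ≠ 0 := by
    rw [hm_def]
    exact_mod_cast (Nat.card_pos (α := φ.toAddMonoidHom.ker)).ne'
  set μ := Isogeny.zsmul W m hm with hμ
  obtain ⟨⟨w₁, hw₁⟩, ⟨w₂, hw₂⟩⟩ := φ.exists_pullbackHom_eq_pullback_zsmul_card_ker hm
  obtain ⟨g₁, h₁, hh₁, rfl⟩ := exists_eq_evalGeneric_div w₁
  obtain ⟨g₂, h₂, hh₂, rfl⟩ := exists_eq_evalGeneric_div w₂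
  -- the bad set of `Q`'s
  set B : Set W'.geomPoints := {0} ∪ φ '' φ.badSet ∪ φ '' (geomTorsion W m : Set W.geomPoints) ∪
    {Q | Q ≠ 0 ∧ MvPolynomial.eval (xy Q) h₁ = 0} ∪ {Q | Q ≠ 0 ∧ MvPolynomial.eval (xy Q) h₂ = 0}
    with hB
  have hBfin : B.Finite :=
    ((((Set.finite_singleton _).union (φ.finite_badSet'.image _)).union
      ((finite_geomTorsion W hm).image _)).union (finite_setOf_eval_xy_eq_zero hh₁)).union
      (finite_setOf_eval_xy_eq_zero hh₂)
  refine ⟨g₁, h₁, g₂, h₂, hBfin.subset fun Q hQ ↦ ?_⟩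
  by_contra hQB
  apply hQ
  simp only [hB, Set.mem_union, Set.mem_singleton_iff, Set.mem_image, Set.mem_setOf_eq, not_or,
    not_exists, not_and, SetLike.mem_coe] at hQB
  obtain ⟨⟨⟨⟨hQ0, hQbad⟩, hQtor⟩, hQh₁⟩, hQh₂⟩ := hQB
  have hQh₁' : MvPolynomial.eval (xy Q) h₁ ≠ 0 := fun h ↦ hQh₁ hQ0 h
  have hQh₂' : MvPolynomial.eval (xy Q) h₂ ≠ 0 := fun h ↦ hQh₂ hQ0 h
  obtain ⟨P, rfl⟩ := φ.surjective Q
  have hPgood : AgreesWithRationalMapAt W W' φ.rationalRep.P₁ φ.rationalRep.Q₁ φ.rationalRep.P₂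
      φ.rationalRep.Q₂ φ P := by
    by_contra h
    exact hQbad P h rfl
  have hP0 : P ≠ 0 := (agreesWithRationalMapAt_iff.mp hPgood).1
  have hmP : m • P ≠ 0 := fun h ↦ hQtor P ((mem_torsionPoints_iff _ _ P).mpr h) rfl
  -- `ψ (φ P) = m • P` is affine
  obtain ⟨a, b, hab, e⟩ := geomPoints.exists_eq_some hmP
  -- values at `P`: of `[m]^* x` and of `φ^* (g₁/h₁)`
  have hvx : W.HasValueAt μ.pullbackX P a := by
    have h := hasValueAt_pullbackX_zsmul hm hmP
    rw [e, xy_some] at h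
    exact h
  have hvy : W.HasValueAt μ.pullbackY P b := by
    have h := hasValueAt_pullbackY_zsmul hm hmP
    rw [e, xy_some] at h
    exact h
  rw [← hw₁] at hvx
  rw [← hw₂] at hvy
  have ha := hvx.unique hP0 (φ.hasValueAt_pullbackHom_evalGeneric_div hPgood g₁ h₁ hQh₁')
  have hb := hvy.unique hP0 (φ.hasValueAt_pullbackHom_evalGeneric_div hPgood g₂ h₂ hQh₂')
  refine agreesWithRationalMapAt_of_hasValue hQ0 (x := a) (y := b) (h := hab) ?_ ?_ ?_
  · exact (hψ P).trans e
  · exact (RatFrac.hasValue_mk hQh₁').congr ha.symm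
  · exact (RatFrac.hasValue_mk hQh₂').congr hb.symm

/-- **The dual isogeny in characteristic `0`** (Silverman, *AEC*, Thm. III.6.1(a)): for an isogeny
`φ : E → E'` of elliptic curves over a field `K` of characteristic `0` there is an isogeny
`ψ = φ̂ : E' → E` over `K` with `ψ ∘ φ = [m]`, `m = #ker φ` (which is `deg φ` in characteristic `0`,
and is the prelude's `Isogeny.degree`). Construction: `ker φ ⊆ E[m]` and `φ` is separable, so
`[m]` factors through `φ` (Cor. III.4.11); here: `φ` is onto `K̄`-points, `ψ := [m] ∘ φ⁻¹` is a
homomorphism, algebraic (`isAlgebraicOn_of_comp_eq_card_ker_zsmul`), `Γ_K`-equivariant (as `φ`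
and `[m]` are, `φ` being onto) and of finite kernel. This is the prelude's named fact
`Isogeny.exists_dual` under the hypotheses `[W.IsElliptic] [W'.IsElliptic]` of its source
(III.6.1 concerns elliptic curves; the prelude's `def` omits them).
[cite: SilvermanAEC2009, Thm. III.6.1(a)] -/
theorem Isogeny.exists_dual_of_isElliptic [CharZero K] (φ : Isogeny W W') :
    ∃ ψ : Isogeny W' W, ∀ P, ψ (φ P) = (φ.degree : ℤ) • P := by
  obtain ⟨ψ, hψ⟩ := exists_addMonoidHom_comp_eq_card_ker_zsmul φ
  have halg : IsAlgebraicOn W' W ψ := isAlgebraicOn_of_comp_eq_card_ker_zsmul φ hψ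
  refine ⟨⟨ψ, halg, fun σ Q ↦ ?_, halg.finite_ker⟩, fun P ↦ hψ P⟩
  obtain ⟨P, rfl⟩ := φ.surjective Q
  rw [← φ.map_smul, hψ, hψ]
  exact (map_zsmul (DistribSMul.toAddMonoidHom W.geomPoints σ) _ P).symm

/-- **Isogeny is symmetric in characteristic `0`** (the dual isogeny): the named facts
`Isogeny.nonempty_symm` / `IsIsogenous.symm` of the prelude, under the hypotheses
`[CharZero K] [W.IsElliptic] [W'.IsElliptic]`. Silverman, *AEC*, Thm. III.6.1(a).
[cite: SilvermanAEC2009, Thm. III.6.1(a)] -/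
theorem Isogeny.nonempty_symm_of_charZero [CharZero K] (φ : Isogeny W W') :
    Nonempty (Isogeny W' W) :=
  let ⟨ψ, _⟩ := φ.exists_dual_of_isElliptic
  ⟨ψ⟩

/-- **`IsIsogenous` is symmetric in characteristic `0`** (for elliptic curves).
Silverman, *AEC*, Thm. III.6.1(a), III.6.2. [cite: SilvermanAEC2009, Thm. III.6.1(a)] -/
theorem IsIsogenous.symm_of_charZero [CharZero K] (h : W.IsIsogenous W') : W'.IsIsogenous W :=
  h.elim fun φ ↦ Isogeny.nonempty_symm_of_charZero φ

end Dual

end WeierstrassCurve
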